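import Summits.BirchSwinnertonDyer.BirchSwinnertonDyer.Theorems.SignedLowerHalvesSprungLowerHalfAtThreeFWLocus
import Summits.BirchSwinnertonDyer.Rank1Residual.Supersingular.RankZeroUpperBoundProp48
import Literature.NumberTheory.EllipticCurves.CastellaCiperianiSkinnerSprung2018.NonordinaryPPartOPEN
import Literature.NumberTheory.EllipticCurves.Rank1Residual.X9NoEntry
import Summits.BirchSwinnertonDyer.BirchSwinnertonDyer.Theorems.SignedLowerHalvesKobayashiMainConjectureSmallImageNoEngine
import HarnessLib

/-!
# Route `SignedLowerHalves`, crux `SprungLowerHalfAtThree` (item stmt-BirchSwinnertonDyer-19003): the REACH of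
# the two PRE binders for clause (B) — on X8 ∩ {`ρ̄_{E,3}` NOT onto} NEITHER the CCSS binder (semistable)
# NOR the Fouquet–Wan binders (FW locus) can be instantiated, and Kato's (12.5.2) fails; on X8 ∩ {onto}
# (12.5.2) HOLDS (A-KATO-3 is void) — kernel obstructions / discharges (cell `bsd-ssimc`, seat
# `bsd-ssimc-k3-c5` gen 2; a `--supports … --as helper` file, closes nothing)

PARTITION (cell bsd-ssimc): X8 (A8) × the 61 small-image (3Nn) cells of the 217-cell window (rank 0: 60,
rank 1: 1) — types-the-object-of (negatively: no claimed engine); and × the 156 large-image cells (rank 0: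
82, rank 1: 74) — Kato's (12.5.2) discharged in the kernel. Closes NONE. THEOREMS ONLY; nothing booked.

Why this file (honest): crux 5 is typed over ALL of class X8 (`p = 3`, good supersingular, `a_3 = ±3`) —
large AND small mod-3 image, every rank — although the leaf uses it only on `r_an = 0 ∧ surj` and the route
declares the rest residual (item `SharpFlatResiduePPart`). The cell's two PRE-claimed engines for clause (B)
(companion files `…FWLocus.lean` p418174, `…Semistable.lean`) need `Semistable W` (Castella–Çiperiani–
Skinner–Sprung Thm. C, `thmCD_pPart_OPEN`) or a NON-SPLIT multiplicative prime `ℓ ≠ 3` with `3 ∤ ord_ℓ(Δ)`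
(Fouquet–Wan Thm. 5.1 / Cor. 5.3 / 5.4, `cor54_pPart_rankZero_OPEN`). Both hypotheses FORCE `ρ̄_{E,3}`
onto (Serre 1972 Prop. 21 i) for semistable curves at a supersingular prime — tree theorem
`ClassX8.surj_of_semistable`; a ramified multiplicative prime gives a transvection, and irreducible +
transvection ⇒ onto — tree theorem `surj_of_irr_of_ram`, with `ClassX8.irr'`). So on X8 ∩ {¬surj} — the
normaliser-of-non-split-Cartan image 3Nn, 61 cells of the window, 28 % — crux 5's clause (B) has NO claimed
engine at all, refereed or not (the exact X8 analogue of `smallImage_no_engine` for crux 4, file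
`SignedLowerHalvesKobayashiMainConjectureSmallImageNoEngine.lean`, p418219); and the integral Kato
divisibility (Kato 2004 (12.5.2), Sprung 2012 Thm. 7.16's hypothesis for the ♯/♭ Kato direction) fails there
too. Conversely, on X8 ∩ {surj} Kato's (12.5.2) — Fouquet–Wan's (TheoKatoIntro) image hypothesis, the cell's
audit item A-KATO-3 at `p = 3` — HOLDS by Wuthrich 2014 Lemma 20 (`3² ∤ N` at a good `3`; tree theorem
`ClassX8.imageContainsSL2_of_surj`), so the ORDERS v11.1 (a) «mod-9 image census» for the 217 X8 cells needs
no computation: (12.5.2) holds on exactly the 156 large-image cells and fails on exactly the 61 small-image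
ones. Nothing here is a claim about the crux itself (OPEN).

References: [Serre1972] §2.4 Prop. 15, §5.4 Prop. 21 i), §1.11 Prop. 12; [Wuthrich2014] Lemma 20;
[Kato2004Asterisque] (12.5.2); [CastellaCiperianiSkinnerSprung2018] Thm. C (PRE); [FouquetWan2021] Thm. 5.1,
Cor. 5.3, Cor. 5.4 (PRE); [Sprung2012] Thm. 7.16.
-/

set_option autoImplicit false
set_option linter.dupNamespace false

noncomputable section

open scoped Classical

open WeierstrassCurve Literature.NumberTheory.EllipticCurves
  Literature.NumberTheory.EllipticCurves.Rank1Residual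
  Literature.NumberTheory.EllipticCurves.CastellaCiperianiSkinnerSprung2018
  Summit.BirchSwinnertonDyer.Rank1Residual.Supersingular

namespace Summit.BirchSwinnertonDyer.BirchSwinnertonDyer.Theorems

section SmallImage

variable (W : WeierstrassCurve ℚ) [W.IsElliptic] [W.IsGloballyMinimal] (p : ℕ) [Fact p.Prime]

/-- **X8 ∩ {¬surj} is NON-semistable** (contrapositive of Serre's Prop. 21 i): a semistable curve with
supersingular `3` has `ρ̄_{E,3}` onto — `ClassX8.surj_of_semistable`). So the CCSS binder `thmCD_pPart_OPEN`
(«semistable abelian variety of GL₂-type») never speaks about a small-image X8 pair.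
[cite: Serre1972, §5.4 Prop. 21 i)] -/
theorem X8_smallImage_not_semistable (hX : ClassX8 W p) (hs : ¬ Surj W p) : ¬ Semistable W := by
  obtain ⟨rfl, -, -⟩ := id hX
  exact fun hsst ↦ hs (ClassX8.surj_of_semistable W 3 hX hsst)

/-- **X8 ∩ {¬surj} has NO ramified multiplicative prime** (`¬ Ram W 3`: every multiplicative `ℓ` has
`3 ∣ ord_ℓ(Δ_min)`): irreducible (`ClassX8.irr'`, Serre Prop. 12) + a transvection would force onto
(`surj_of_irr_of_ram`). [cite: Serre1972, §2.4 Prop. 15] -/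
theorem X8_smallImage_not_ram (hX : ClassX8 W p) (hs : ¬ Surj W p) : ¬ Ram W p :=
  not_ram_of_irr_of_not_surj W p (ClassX8.irr' W p hX) hs

/-- **The Fouquet–Wan locus is EMPTY on X8 ∩ {¬surj}**: there is no prime `ℓ ≠ 3` of non-split
multiplicative reduction with `3 ∤ ord_ℓ(Δ_min)` — the locus hypothesis, verbatim, of the OPEN binders
`FouquetWan2021.cor54_pPart_rankZero_OPEN` / `cor53_finiteSelmer_iff_rankZero_OPEN` (and of the Summits-side
`FouquetWan2021_thm51_via_kobayashi74_OPEN`). [cite: Serre1972, §2.4 Prop. 15] -/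
theorem X8_smallImage_not_fwLocus (hX : ClassX8 W p) (hs : ¬ Surj W p) :
    ¬ ∃ (ℓ : ℕ) (_ : Fact ℓ.Prime), ℓ ≠ p ∧ W.HasMultiplicativeReductionAtPrime ℓ ∧
        ¬ W.HasSplitMultiplicativeReductionAtPrime ℓ ∧ ¬ p ∣ padicValInt ℓ W.minimalDiscriminantInt := by
  rintro ⟨ℓ, hℓ, hℓp, hmult, -, hdiv⟩
  exact X8_smallImage_not_ram W p hX hs ⟨ℓ, hℓ, hℓp, hmult, hdiv⟩

/-- **Assembly — X8 ∩ {¬surj}: no claimed engine for crux 5's clause (B).** On an X8 pair whose mod-3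
representation is not onto: the curve is not semistable (CCSS Thm. C void), carries no ramified — a fortiori
no non-split ramified — multiplicative prime (Fouquet–Wan Thm. 5.1 / Cor. 5.3 / Cor. 5.4 void), and fails
Kato's (12.5.2) (integral Kato / Sprung 2012 Thm. 7.16 void; the image-free lemma `smallImage_not_imageContainsSL2` of the crux-4 file is reused). The 61 small-image cells of board A8 (60 of
rank 0) are exactly this locus in the window. Kernel obstruction; nothing about the crux is claimed.
[cite: Serre1972, §2.4 Prop. 15 and §5.4 Prop. 21 i)] [cite: Kato2004Asterisque, (12.5.2) (p. 222)] -/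
theorem X8_smallImage_no_engine (hX : ClassX8 W p) (hs : ¬ Surj W p) :
    ¬ Semistable W ∧ ¬ Ram W p ∧
      (¬ ∃ (ℓ : ℕ) (_ : Fact ℓ.Prime), ℓ ≠ p ∧ W.HasMultiplicativeReductionAtPrime ℓ ∧
        ¬ W.HasSplitMultiplicativeReductionAtPrime ℓ ∧ ¬ p ∣ padicValInt ℓ W.minimalDiscriminantInt) ∧
      ¬ Kato2004.ImageContainsSL2 W p :=
  ⟨X8_smallImage_not_semistable W p hX hs, X8_smallImage_not_ram W p hX hs,
    X8_smallImage_not_fwLocus W p hX hs, smallImage_not_imageContainsSL2 W p hs⟩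

end SmallImage

section LargeImage

variable (W : WeierstrassCurve ℚ) [W.IsElliptic] [W.IsGloballyMinimal] (p : ℕ) [Fact p.Prime]

/-- **A-KATO-3 is VOID on both PRE loci of X8.** On an X8 pair that is semistable OR carries a Fouquet–Wan
prime (non-split multiplicative `ℓ ≠ 3`, `3 ∤ ord_ℓ(Δ_min)`), `ρ̄_{E,3}` is onto (Serre Prop. 21 i), resp.
irreducible + transvection) and hence `SL₂(ℤ_3) ⊆ ρ_{E,3^∞}(G_{ℚ(ζ_{3^∞})})` — Kato's (12.5.2), the image
hypothesis of Fouquet–Wan's (TheoKatoIntro) and of Sprung 2012 Thm. 7.16 — by Wuthrich 2014 Lemma 20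
(`ClassX8.imageContainsSL2_of_surj`). So the cell's audit item A-KATO-3 does not bite on any X8 cell the two
binders reach; the mod-9 image census asked by ORDERS v11.1 (a) is settled without computation.
[cite: Wuthrich2014, Lemma 20 (p. 399)] [cite: Serre1972, §5.4 Prop. 21 i) and §2.4 Prop. 15]
[cite: Kato2004Asterisque, (12.5.2) in Thm. 12.5 (4) (p. 222)] -/
theorem X8_imageContainsSL2_of_semistable_or_fwLocus (hX : ClassX8 W p)
    (hloc : Semistable W ∨
      ∃ (ℓ : ℕ) (_ : Fact ℓ.Prime), ℓ ≠ p ∧ W.HasMultiplicativeReductionAtPrime ℓ ∧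
        ¬ W.HasSplitMultiplicativeReductionAtPrime ℓ ∧ ¬ p ∣ padicValInt ℓ W.minimalDiscriminantInt) :
    Surj W p ∧ Kato2004.ImageContainsSL2 W p := by
  have hs : Surj W p := by
    by_contra hns
    rcases hloc with hsst | hFW
    · exact X8_smallImage_not_semistable W p hX hns hsst
    · exact X8_smallImage_not_fwLocus W p hX hns hFW
  exact ⟨hs, ClassX8.imageContainsSL2_of_surj W p hX hs⟩

end LargeImage

end Summit.BirchSwinnertonDyer.BirchSwinnertonDyer.Theorems

end
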